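import Summits.CriticalPhenomena.PercolationContinuityZ3.Theorems.PercNearOneGluingNoHeavyQuantGluedFourComponents
import HarnessLib

/-!
# QUANT lane R8, T-DEC: THE IDENTICAL GLUED QUADRUPLE `(R^r[q](R^k[g]))⁴` IS SDEC AT ITS TRUE FLOOR `q·g` FOR EVERY SHAPE AND EVERY
# `q ≤ 3/4` — WITH NO LIFT AT ALL; the three outer-gate mixture identities of width 4 (prim-quant-census-2 gen 80)

builds on p205010 (kernel theorem, internal audit signed; external expert review pending)

Support file (`--supports stmt-CriticalPhenomena-4575`), QUANT lane census seat prim-quant-census-2 (gen 80); memo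
`run/shared/lean/prim/quant/prim-quant-census-2-g80/TRIPLE-G80.md` §5.  Theorems only, standard axioms, no sorries, no definitions.

For an outer gate `a` (`m = aq`) the law `gate_a(t_q⁴)` is the convex combination (exact weights, all `≥ 0` since `m ≤ q`; `β = (1−q)³/(1−m)³`)
* **`gate_gluedFour_eq_mix_low`**  (`m ≤ 1/2`):  `α·gate_m(ρ⁴) + β·t_m⁴ + w₃·gate_{4m/3}(ρ³) + w₂·gate_{2m}(ρ²)`,
  `w₃ = 3q(1−q)(1−a)(q+m−2mq)/(1−m)²`, `w₂ = 3q(1−q)²(1−a)/(1−m)`, `α = q³ − m³β`;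
* **`gate_gluedFour_eq_mix_mid`**  (`1/2 < m ≤ 3/4`):  `α·gate_m(ρ⁴) + β·t_m⁴ + w_Q·(gate_m(ρ²) ∗ gate_m(ρ²)) + w₃·gate_{4m/3}(ρ³)`,
  `w_Q = 3q(1−q)²(1−a)/(1−m)²`, `α = q³ − m³β − m·w_Q`;
* **`gate_gluedFour_eq_mix_high`** (`m > 3/4`):  `α·gate_m(ρ⁴) + β·t_m⁴ + w_Q·(gate_m(ρ²) ∗ gate_m(ρ²)) + w_X·(ρ³ ∗ gate_{4m−3} ρ)`,
  `w_X = mq(1−q)(1−a)(q+m−2mq)/(1−m)³`, `α = 1 − β − w_Q − w_X`.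
The first two menus are LIFT-FREE (`…QuantGluedFourComponents`: gated blob laws and `ConvClosedT` products, the quadruple's own binomial via the
WIDTH-3 THEOREM), hence **`sdec_gluedFour_trueFloor_of_le`**: for `q ≤ 3/4` (so `m ≤ 3/4` for every outer gate) the identical glued quadruple is
SDEC at `q·g`, every shape, unconditionally.  The regime `m > 3/4` needs the four-blob lift `ρ³ ∗ gate_c ρ` at floor `(3+c)g/4` (successor file).

HONEST STATUS.  Width 4 for `q ≤ 3/4`; `q > 3/4` pending the four-blob average-gate lemma; `SiblingStep`, `FarTreeRow` OPEN; RATE class (log\*) /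
honest sentence of `run/shared/lean/prim/quant/README.md` unchanged.  [this work].  Nothing here is cited as a published result.  The gluing rows
served [cite: KozmaNitzan2024, Conjecture 3 (p. 15)]; product measure [cite: Grimmett1999, §1.3 p. 10].
-/

noncomputable section

open scoped BigOperators

namespace Summit.CriticalPhenomena.PercolationContinuityZ3.Theorems
namespace Quant
namespace LawDec

open Finset

/-! ### The pair of gated sure pairs and the top lift in the basis -/

/-- `gate_m(ρ²) ∗ gate_m(ρ²) = m²·ρ⁴ + 2m(1−m)·ρ² + (1−m)²·δ₀` (with `ρ² ∗ ρ² = ρ³ ∗ ρ`). [this work] -/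
theorem gatedPairPair_expand (M : ℕ) (ρ : ℕ → ℝ) (m : ℝ) (h : ℕ) :
    lconv (M + M) (M + M) (gate (lconv M M ρ ρ) m) (gate (lconv M M ρ ρ) m) h
      = m * m * lconv (M + M + M) M (lconv (M + M) M (lconv M M ρ ρ) ρ) ρ h + (m * (1 - m) + (1 - m) * m) * lconv M M ρ ρ h
        + (1 - m) * (1 - m) * (if h = 0 then (1 : ℝ) else 0) := by
  have h2M : ∀ t, M + M < t → lconv M M ρ ρ t = 0 := fun t ht => lconv_eq_zero M M ρ ρ t ht
  rw [gatedPair_expand (M + M) _ h2M m m h, lconv_assoc (M + M) M M (lconv M M ρ ρ) ρ ρ]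

/-- the weight `α` of the middle regime is nonnegative: `m³(1−q)³ + m·3q(1−q)²(1−a)(1−m) ≤ q³(1−m)³` for `m = aq > 1/2`. [this work] -/
theorem gluedFour_alpha_mid_key (a q : ℝ) (ha0 : 0 < a) (ha1 : a ≤ 1) (hq0 : 0 < q) (hq1 : q < 1) (hm : 1 / 2 < a * q) :
    (a * q) ^ 3 * (1 - q) ^ 3 + (a * q) * (3 * q * (1 - q) ^ 2 * (1 - a)) * (1 - a * q) ≤ q ^ 3 * (1 - a * q) ^ 3 := by
  have h1 : 0 ≤ 1 - a := by linarith
  have h2 : 0 < 1 - q := by linarith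
  have hmq : a * q ≤ q := by nlinarith
  have key : 0 ≤ q ^ 3 * (1 - a * q) ^ 3 - ((a * q) ^ 3 * (1 - q) ^ 3 + (a * q) * (3 * q * (1 - q) ^ 2 * (1 - a)) * (1 - a * q)) := by
    have e : q ^ 3 * (1 - a * q) ^ 3 - ((a * q) ^ 3 * (1 - q) ^ 3 + (a * q) * (3 * q * (1 - q) ^ 2 * (1 - a)) * (1 - a * q))
        = q * (1 - a) * (q ^ 2 * ((1 - a * q) ^ 2 + (1 - a * q) * a * (1 - q) + a ^ 2 * (1 - q) ^ 2)
            - 3 * a * q * (1 - q) ^ 2 * (1 - a * q)) := by ring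
    rw [e]
    apply mul_nonneg (mul_nonneg hq0.le h1)
    nlinarith [mul_pos hq0 ha0, sq_nonneg (1 - q), mul_nonneg (mul_nonneg ha0.le hq0.le) h2.le,
      mul_nonneg (by linarith : 0 ≤ 2 * a * q - 1) h2.le, mul_nonneg (mul_nonneg (by linarith : 0 ≤ 2 * a * q - 1) h2.le) h2.le]
  linarith

/-! ### The outer-gate mixture identities of width 4 -/

/-- **MIXTURE, `m = aq ≤ 1/2`.** [this work] -/
theorem gate_gluedFour_eq_mix_low (M : ℕ) (ρ : ℕ → ℝ) (hρM : ∀ h, M < h → ρ h = 0) (a q : ℝ) (hm : 1 - a * q ≠ 0) (h : ℕ) :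
    gate (lconv (M + M + M) M (lconv (M + M) M (lconv M M (gate ρ q) (gate ρ q)) (gate ρ q)) (gate ρ q)) a h
      = (q ^ 3 - (a * q) ^ 3 * ((1 - q) ^ 3 / (1 - a * q) ^ 3))
          * gate (lconv (M + M + M) M (lconv (M + M) M (lconv M M ρ ρ) ρ) ρ) (a * q) h
        + ((1 - q) ^ 3 / (1 - a * q) ^ 3)
          * lconv (M + M + M) M (lconv (M + M) M (lconv M M (gate ρ (a * q)) (gate ρ (a * q))) (gate ρ (a * q))) (gate ρ (a * q)) h
        + (3 * q * (1 - q) * (1 - a) * (q + a * q - 2 * (a * q) * q) / (1 - a * q) ^ 2)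
          * gate (lconv (M + M) M (lconv M M ρ ρ) ρ) (4 * (a * q) / 3) h
        + (3 * q * (1 - q) ^ 2 * (1 - a) / (1 - a * q)) * gate (lconv M M ρ ρ) (2 * (a * q)) h := by
  have hm' : 1 - q * a ≠ 0 := by rwa [mul_comm] at hm
  rw [gate_apply, gate_apply, gate_apply, gate_apply, gatedQuadruple_expand M ρ hρM q q q q h,
    gatedQuadruple_expand M ρ hρM (a * q) (a * q) (a * q) (a * q) h]
  field_simp
  ring

/-- **MIXTURE, `1/2 < m = aq ≤ 3/4`.** [this work] -/
theorem gate_gluedFour_eq_mix_mid (M : ℕ) (ρ : ℕ → ℝ) (hρM : ∀ h, M < h → ρ h = 0) (a q : ℝ) (hm : 1 - a * q ≠ 0) (h : ℕ) :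
    gate (lconv (M + M + M) M (lconv (M + M) M (lconv M M (gate ρ q) (gate ρ q)) (gate ρ q)) (gate ρ q)) a h
      = (q ^ 3 - (a * q) ^ 3 * ((1 - q) ^ 3 / (1 - a * q) ^ 3) - (a * q) * (3 * q * (1 - q) ^ 2 * (1 - a) / (1 - a * q) ^ 2))
          * gate (lconv (M + M + M) M (lconv (M + M) M (lconv M M ρ ρ) ρ) ρ) (a * q) h
        + ((1 - q) ^ 3 / (1 - a * q) ^ 3)
          * lconv (M + M + M) M (lconv (M + M) M (lconv M M (gate ρ (a * q)) (gate ρ (a * q))) (gate ρ (a * q))) (gate ρ (a * q)) h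
        + (3 * q * (1 - q) ^ 2 * (1 - a) / (1 - a * q) ^ 2)
          * lconv (M + M) (M + M) (gate (lconv M M ρ ρ) (a * q)) (gate (lconv M M ρ ρ) (a * q)) h
        + (3 * q * (1 - q) * (1 - a) * (q + a * q - 2 * (a * q) * q) / (1 - a * q) ^ 2)
          * gate (lconv (M + M) M (lconv M M ρ ρ) ρ) (4 * (a * q) / 3) h := by
  have hm' : 1 - q * a ≠ 0 := by rwa [mul_comm] at hm
  rw [gate_apply, gate_apply, gate_apply, gatedQuadruple_expand M ρ hρM q q q q h,
    gatedQuadruple_expand M ρ hρM (a * q) (a * q) (a * q) (a * q) h, gatedPairPair_expand M ρ (a * q) h]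
  field_simp
  ring

/-- **MIXTURE, `m = aq > 3/4`** (the top lift `ρ³ ∗ gate_{4m−3} ρ`). [this work] -/
theorem gate_gluedFour_eq_mix_high (M : ℕ) (ρ : ℕ → ℝ) (hρM : ∀ h, M < h → ρ h = 0) (a q : ℝ) (hm : 1 - a * q ≠ 0) (h : ℕ) :
    gate (lconv (M + M + M) M (lconv (M + M) M (lconv M M (gate ρ q) (gate ρ q)) (gate ρ q)) (gate ρ q)) a h
      = (1 - (1 - q) ^ 3 / (1 - a * q) ^ 3 - 3 * q * (1 - q) ^ 2 * (1 - a) / (1 - a * q) ^ 2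
            - (a * q) * q * (1 - q) * (1 - a) * (q + a * q - 2 * (a * q) * q) / (1 - a * q) ^ 3)
          * gate (lconv (M + M + M) M (lconv (M + M) M (lconv M M ρ ρ) ρ) ρ) (a * q) h
        + ((1 - q) ^ 3 / (1 - a * q) ^ 3)
          * lconv (M + M + M) M (lconv (M + M) M (lconv M M (gate ρ (a * q)) (gate ρ (a * q))) (gate ρ (a * q))) (gate ρ (a * q)) h
        + (3 * q * (1 - q) ^ 2 * (1 - a) / (1 - a * q) ^ 2)
          * lconv (M + M) (M + M) (gate (lconv M M ρ ρ) (a * q)) (gate (lconv M M ρ ρ) (a * q)) h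
        + ((a * q) * q * (1 - q) * (1 - a) * (q + a * q - 2 * (a * q) * q) / (1 - a * q) ^ 3)
          * lconv (M + M + M) M (lconv (M + M) M (lconv M M ρ ρ) ρ) (gate ρ (4 * (a * q) - 3)) h := by
  have hm' : 1 - q * a ≠ 0 := by rwa [mul_comm] at hm
  have h3M : ∀ t, M + M + M < t → lconv (M + M) M (lconv M M ρ ρ) ρ t = 0 := fun t ht => lconv_eq_zero _ _ _ _ t ht
  rw [gate_apply, gate_apply, gatedQuadruple_expand M ρ hρM q q q q h,
    gatedQuadruple_expand M ρ hρM (a * q) (a * q) (a * q) (a * q) h, gatedPairPair_expand M ρ (a * q) h,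
    lconv_gate_right (M + M + M) M _ ρ (4 * (a * q) - 3) h3M h]
  field_simp
  ring

/-! ### The identical glued quadruple at its true floor, `q ≤ 3/4` -/

/-- **THE IDENTICAL GLUED QUADRUPLE AT ITS TRUE FLOOR FOR `q ≤ 3/4` — EVERY SHAPE, NO LIFT.**  `ρ = blobLaw [(k,g),(r,1)]`, `t = gate_q ρ`,
`0 < q ≤ 3/4`, `0 < g < 1`: `SDEC (q·g) (4(r+k)) (((t ∗ t) ∗ t) ∗ t)`. [this work] -/
theorem sdec_gluedFour_trueFloor_of_le (r k : ℕ) {q g : ℝ} (hq0 : 0 < q) (hq34 : q ≤ 3 / 4) (hg0 : 0 < g) (hg1 : g < 1) :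
    SDEC (q * g) ((r + k) + (r + k) + (r + k) + (r + k))
      (lconv ((r + k) + (r + k) + (r + k)) (r + k)
        (lconv ((r + k) + (r + k)) (r + k)
          (lconv (r + k) (r + k) (gate (blobLaw [(k, g), (r, 1)]) q) (gate (blobLaw [(k, g), (r, 1)]) q))
          (gate (blobLaw [(k, g), (r, 1)]) q))
        (gate (blobLaw [(k, g), (r, 1)]) q)) := by
  intro a ha0 ha1 j hj
  set ρ : ℕ → ℝ := blobLaw [(k, g), (r, 1)] with hρ
  have hq1 : q < 1 := by linarith
  have hm0 : 0 < a * q := mul_pos ha0 hq0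
  have hmq : a * q ≤ q := by nlinarith
  have hm1 : a * q < 1 := lt_of_le_of_lt hmq hq1
  have hm34 : a * q ≤ 3 / 4 := hmq.trans hq34
  have hmne : 1 - a * q ≠ 0 := by linarith
  have hmne' : 1 - q * a ≠ 0 := by rwa [mul_comm] at hmne
  have hβ0 : 0 ≤ (1 - q) ^ 3 / (1 - a * q) ^ 3 := div_nonneg (pow_nonneg (by linarith) 3) (pow_nonneg (by linarith) 3)
  have hqm : 0 ≤ q + a * q - 2 * (a * q) * q := by nlinarith [mul_nonneg hm0.le (by linarith : 0 ≤ 1 - q)]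
  have hw3 : 0 ≤ 3 * q * (1 - q) * (1 - a) * (q + a * q - 2 * (a * q) * q) / (1 - a * q) ^ 2 :=
    div_nonneg (mul_nonneg (mul_nonneg (mul_nonneg (by positivity) (by linarith)) (by linarith)) hqm) (sq_nonneg _)
  -- laws and the mean of the gated quadruple
  obtain ⟨a0, aM, a1, amn⟩ := glued_blob_laws r k hg0.le hg1.le
  obtain ⟨u0, uM, u1⟩ := gate_laws (r + k) ρ q hq0.le hq1.le a0 aM a1
  have umn : ∑ h ∈ Finset.range (r + k + 1), (h : ℝ) * gate ρ q h = q * ((r : ℝ) + k * g) := by rw [sum_mul_gate, amn]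
  obtain ⟨p0, pM, p1, pmn⟩ := lconv_laws u0 u1 umn u0 u1 umn
  obtain ⟨t0, tM, t1, tmn⟩ := lconv_laws p0 p1 pmn u0 u1 umn
  obtain ⟨f0, fM, f1, fmn⟩ := lconv_laws t0 t1 tmn u0 u1 umn
  rw [decAt_iff_decAtT, sum_mul_gate, fmn]
  have eT : a * (q * ((r : ℝ) + k * g) + q * ((r : ℝ) + k * g) + q * ((r : ℝ) + k * g) + q * ((r : ℝ) + k * g))
      = 4 * ((a * q) * ((r : ℝ) + k * g)) := by ring
  have ex : a * (q * g) = (a * q) * g := by ring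
  rw [eT, ex]
  -- common components
  have hC := decAtT_comp4_blob4 r k hg0 hg1 hm0 hm1.le j hj
  have hB := decAtT_comp4_binomial r k hg0 hg1 hm0 hm1 j hj
  have hG3 := decAtT_comp4_blob3g r k hg0 hg1 hm0 (e := 4 * (a * q) / 3) (by ring) (by linarith) j
  by_cases hcase : a * q ≤ 1 / 2
  · -- {gate_m ρ⁴, t_m⁴, gate_{4m/3} ρ³, gate_{2m} ρ²}
    have hG2 := decAtT_comp4_blob2g r k hg0 hg1 hm0 (e := 2 * (a * q)) rfl (by linarith) j
    have hα0 : 0 ≤ q ^ 3 - (a * q) ^ 3 * ((1 - q) ^ 3 / (1 - a * q) ^ 3) := by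
      have h1 : a * q * (1 - q) ≤ q * (1 - a * q) := by nlinarith
      have h2 : (a * q * (1 - q)) ^ 3 ≤ (q * (1 - a * q)) ^ 3 :=
        pow_le_pow_left₀ (mul_nonneg hm0.le (by linarith)) h1 3
      have hpos : 0 < (1 - a * q) ^ 3 := pow_pos (by linarith) 3
      rw [sub_nonneg, ← mul_div_assoc, div_le_iff₀ hpos]
      nlinarith
    have hw2 : 0 ≤ 3 * q * (1 - q) ^ 2 * (1 - a) / (1 - a * q) :=
      div_nonneg (mul_nonneg (mul_nonneg (by positivity) (sq_nonneg _)) (by linarith)) (by linarith)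
    refine decAtT_finite_mixture (ι := Fin 4) _ _ j _ _
      ![q ^ 3 - (a * q) ^ 3 * ((1 - q) ^ 3 / (1 - a * q) ^ 3), (1 - q) ^ 3 / (1 - a * q) ^ 3,
        3 * q * (1 - q) * (1 - a) * (q + a * q - 2 * (a * q) * q) / (1 - a * q) ^ 2, 3 * q * (1 - q) ^ 2 * (1 - a) / (1 - a * q)]
      ![gate (lconv ((r + k) + (r + k) + (r + k)) (r + k) (lconv ((r + k) + (r + k)) (r + k) (lconv (r + k) (r + k) ρ ρ) ρ) ρ) (a * q),
        lconv ((r + k) + (r + k) + (r + k)) (r + k)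
          (lconv ((r + k) + (r + k)) (r + k) (lconv (r + k) (r + k) (gate ρ (a * q)) (gate ρ (a * q))) (gate ρ (a * q))) (gate ρ (a * q)),
        gate (lconv ((r + k) + (r + k)) (r + k) (lconv (r + k) (r + k) ρ ρ) ρ) (4 * (a * q) / 3),
        gate (lconv (r + k) (r + k) ρ ρ) (2 * (a * q))]
      ?_ ?_ (fun h => ?_) ?_
    · intro i; fin_cases i
      · exact hα0
      · exact hβ0
      · exact hw3
      · exact hw2
    · rw [Fin.sum_univ_four]
      show q ^ 3 - (a * q) ^ 3 * ((1 - q) ^ 3 / (1 - a * q) ^ 3) + (1 - q) ^ 3 / (1 - a * q) ^ 3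
        + 3 * q * (1 - q) * (1 - a) * (q + a * q - 2 * (a * q) * q) / (1 - a * q) ^ 2 + 3 * q * (1 - q) ^ 2 * (1 - a) / (1 - a * q) = 1
      field_simp
      ring
    · rw [Fin.sum_univ_four]
      exact gate_gluedFour_eq_mix_low (r + k) ρ aM a q hmne h
    · intro i hi
      fin_cases i
      · exact hC
      · exact hB
      · exact hG3
      · exact hG2
  · -- {gate_m ρ⁴, t_m⁴, gate_m ρ² ∗ gate_m ρ², gate_{4m/3} ρ³}
    have hQ := decAtT_comp4_pairpair r k hg0 hg1 hm0 hm1.le j hj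
    have hwQ : 0 ≤ 3 * q * (1 - q) ^ 2 * (1 - a) / (1 - a * q) ^ 2 :=
      div_nonneg (mul_nonneg (mul_nonneg (by positivity) (sq_nonneg _)) (by linarith)) (sq_nonneg _)
    have hα0 : 0 ≤ q ^ 3 - (a * q) ^ 3 * ((1 - q) ^ 3 / (1 - a * q) ^ 3) - (a * q) * (3 * q * (1 - q) ^ 2 * (1 - a) / (1 - a * q) ^ 2) := by
      have hpos : 0 < (1 - a * q) ^ 3 := pow_pos (by linarith) 3
      have key : (a * q) ^ 3 * (1 - q) ^ 3 + (a * q) * (3 * q * (1 - q) ^ 2 * (1 - a)) * (1 - a * q) ≤ q ^ 3 * (1 - a * q) ^ 3 :=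
        gluedFour_alpha_mid_key a q ha0 ha1 hq0 hq1 (lt_of_not_ge hcase)
      have e : q ^ 3 - (a * q) ^ 3 * ((1 - q) ^ 3 / (1 - a * q) ^ 3) - (a * q) * (3 * q * (1 - q) ^ 2 * (1 - a) / (1 - a * q) ^ 2)
          = (q ^ 3 * (1 - a * q) ^ 3 - ((a * q) ^ 3 * (1 - q) ^ 3 + (a * q) * (3 * q * (1 - q) ^ 2 * (1 - a)) * (1 - a * q)))
            / (1 - a * q) ^ 3 := by
        field_simp
        ring
      rw [e]
      exact div_nonneg (by linarith) hpos.le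
    refine decAtT_finite_mixture (ι := Fin 4) _ _ j _ _
      ![q ^ 3 - (a * q) ^ 3 * ((1 - q) ^ 3 / (1 - a * q) ^ 3) - (a * q) * (3 * q * (1 - q) ^ 2 * (1 - a) / (1 - a * q) ^ 2),
        (1 - q) ^ 3 / (1 - a * q) ^ 3, 3 * q * (1 - q) ^ 2 * (1 - a) / (1 - a * q) ^ 2,
        3 * q * (1 - q) * (1 - a) * (q + a * q - 2 * (a * q) * q) / (1 - a * q) ^ 2]
      ![gate (lconv ((r + k) + (r + k) + (r + k)) (r + k) (lconv ((r + k) + (r + k)) (r + k) (lconv (r + k) (r + k) ρ ρ) ρ) ρ) (a * q),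
        lconv ((r + k) + (r + k) + (r + k)) (r + k)
          (lconv ((r + k) + (r + k)) (r + k) (lconv (r + k) (r + k) (gate ρ (a * q)) (gate ρ (a * q))) (gate ρ (a * q))) (gate ρ (a * q)),
        lconv ((r + k) + (r + k)) ((r + k) + (r + k)) (gate (lconv (r + k) (r + k) ρ ρ) (a * q)) (gate (lconv (r + k) (r + k) ρ ρ) (a * q)),
        gate (lconv ((r + k) + (r + k)) (r + k) (lconv (r + k) (r + k) ρ ρ) ρ) (4 * (a * q) / 3)]
      ?_ ?_ (fun h => ?_) ?_
    · intro i; fin_cases i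
      · exact hα0
      · exact hβ0
      · exact hwQ
      · exact hw3
    · rw [Fin.sum_univ_four]
      show q ^ 3 - (a * q) ^ 3 * ((1 - q) ^ 3 / (1 - a * q) ^ 3) - (a * q) * (3 * q * (1 - q) ^ 2 * (1 - a) / (1 - a * q) ^ 2)
        + (1 - q) ^ 3 / (1 - a * q) ^ 3 + 3 * q * (1 - q) ^ 2 * (1 - a) / (1 - a * q) ^ 2
        + 3 * q * (1 - q) * (1 - a) * (q + a * q - 2 * (a * q) * q) / (1 - a * q) ^ 2 = 1
      field_simp
      ring
    · rw [Fin.sum_univ_four]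
      exact gate_gluedFour_eq_mix_mid (r + k) ρ aM a q hmne h
    · intro i hi
      fin_cases i
      · exact hC
      · exact hB
      · exact hQ
      · exact hG3

end LawDec
end Quant
end Summit.CriticalPhenomena.PercolationContinuityZ3.Theorems
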